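import Literature.Probability.RandomPlanarGeometry.ConformalRemovabilityQHBC
import Literature.Probability.RandomPlanarGeometry.ConformalRemovabilityDescendants
import Literature.Probability.RandomPlanarGeometry.ConformalRemovabilityShadowSum
import HarnessLib

/-!
# The rooted Whitney tree of a Hölder domain, packaged (support for Jones–Smirnov 2000, Cor. 2)

P. W. Jones, S. K. Smirnov, *Removability theorems for Sobolev functions and quasiconformal maps*,
Ark. Mat. 38 (2000) 263–279, §§1, 3–4: the Whitney decomposition of `Ω`, the family of curves from
a base point through the Whitney cubes, their landing points and shadows (p. 267), and the graph
of Whitney cubes with its distance to the central cube (proof of Thm. 3, p. 275).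

`WhitneyTree Ω` records the planar disc version produced by `exists_whitneyTree`
(`ConformalRemovabilityQHBC.lean`): a Whitney family `S` of centres for the radius
`r = dist(·, Ωᶜ)/100`, a root, the breadth-first parent map and level function `q` of the graph
of discs, local finiteness, and the quasihyperbolic boundary condition for `q`. For a Hölder
domain (`nonempty_of_holderOnWith`) we derive the inputs of the abstract shadow combinatorics of
`ConformalRemovabilityRays/Descendants/ShadowSum.lean` with `rad = r`, `pos = id`, `κ = 3`:
`dist_parent_le`, `summable_sq` (`Σ_v (q v + 1)² r(v)² < ∞`, from
`summable_sq_mul_sq_of_qhbc`), the tail majorant `exists_tau` (`exists_tailSup`), rays landing at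
every boundary point (`exists_ray_tendsto_of_mem_frontier`, from `exists_ray_tendsto`) and the
landing estimate `dist_ray_le` (`dist(x_k, a) ≤ 6 Σ_{n ≥ k} r(x_n)`).
-/

noncomputable section

open Set Metric MeasureTheory Filter

open scoped NNReal ENNReal Topology

namespace Literature.Probability.RandomPlanarGeometry

open Literature.Analysis.FluidPDE (IsWhitneyFamily)

variable {Ω : Set ℂ}

/-- **The rooted Whitney tree of a planar domain** (Jones–Smirnov 2000, p. 267 and proof of
Thm. 3, p. 275, disc version): a Whitney family `S` of centres for the radius `dist(·, Ωᶜ)/100`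
together with a root, a parent map and a level function `q : ℂ → ℕ` such that `q(root) = 0`,
`q(v) = q(parent v) + 1`, every vertex `v ≠ root` is distinct from and adjacent to its parent
(their triple discs meet), vertices have finitely many children, iterating `parent` leads to the
root, and `q(v) ≤ A log(1/dist(v, Ωᶜ)) + B` (quasihyperbolic boundary condition).
[cite: JonesSmirnov2000, §1 p. 267 and proof of Thm. 3 p. 275] -/
structure WhitneyTree (Ω : Set ℂ) where
  /-- the centres of the Whitney discs -/
  S : Set ℂ
  /-- `S` is a Whitney family for the radius `dist(·, Ωᶜ)/100` -/
  isWhitney : IsWhitneyFamily (fun z => infDist z Ωᶜ / 100) Ω S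
  /-- the root (the disc containing the base point) -/
  root : S
  /-- the parent of a vertex (one step closer to the root; the root is its own parent) -/
  parent : S → S
  /-- the level (graph distance to the root), extended by `0` outside `S` -/
  q : ℂ → ℕ
  /-- the root has level `0` -/
  q_root : q root = 0
  /-- the root is its own parent -/
  parent_root : parent root = root
  /-- the level of a vertex exceeds the level of its parent by one -/
  q_parent : ∀ v : S, v ≠ root → q v = q (parent v) + 1
  /-- a vertex other than the root is distinct from its parent and their triple discs meet -/
  adj_parent : ∀ v : S, v ≠ root → (v : ℂ) ≠ parent v ∧
    (ball (v : ℂ) (3 * (infDist (v : ℂ) Ωᶜ / 100)) ∩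
      ball (parent v : ℂ) (3 * (infDist (parent v : ℂ) Ωᶜ / 100))).Nonempty
  /-- every vertex has finitely many children -/
  finite_children : ∀ v : S, {w : S | parent w = v ∧ w ≠ root}.Finite
  /-- iterating the parent map leads to the root -/
  reach : ∀ v : S, ∃ n, parent^[n] v = root
  /-- the quasihyperbolic boundary condition for the levels -/
  qhbc : ∃ A B : ℝ, 0 ≤ A ∧ ∀ v : S, (q v : ℝ) ≤ A * Real.log (1 / infDist (v : ℂ) Ωᶜ) + B

namespace WhitneyTree

/-- **Hölder domains carry a Whitney tree** (`exists_whitneyTree`). [cite: JonesSmirnov2000, §1 p. 267 and proof of Thm. 3 p. 275] -/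
theorem nonempty_of_holderOnWith (φ : ConformalEquiv (ball (0 : ℂ) 1) Ω) {C α : ℝ≥0}
    (hα : 0 < α) (hH : HolderOnWith C α φ (ball (0 : ℂ) 1)) : Nonempty (WhitneyTree Ω) := by
  obtain ⟨S, hW, root, parent, q, h0, hp0, hq, hadj, hfin, hreach, A, B, hA, hAB⟩ :=
    exists_whitneyTree φ hα hH
  exact ⟨⟨S, hW, root, parent, q, h0, hp0, hq, hadj, hfin, hreach, A, B, hA, hAB⟩⟩

/-- The Whitney radius is nonnegative. [folklore] -/
theorem rad_nonneg (v : ℂ) : 0 ≤ infDist v Ωᶜ / 100 := div_nonneg infDist_nonneg (by norm_num)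

variable (W : WhitneyTree Ω)

/-- The level function as a function on the vertices satisfies the tree relation. [folklore] -/
theorem q_parent' : ∀ v : W.S, v ≠ W.root → (fun v : W.S => W.q v) v =
    (fun v : W.S => W.q v) (W.parent v) + 1 := W.q_parent

/-- A vertex and its parent are at distance `≤ 3 (r(v) + r(parent v))` (their triple discs
meet); the hypothesis `hpos` of the abstract ray lemmas with `κ = 3`. [folklore] -/
theorem dist_parent_le (v : W.S) : dist (v : ℂ) (W.parent v) ≤
    3 * (infDist (v : ℂ) Ωᶜ / 100 + infDist (W.parent v : ℂ) Ωᶜ / 100) := by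
  by_cases hv : v = W.root
  · rw [hv, W.parent_root, dist_self]
    linarith [rad_nonneg (Ω := Ω) (W.root : ℂ)]
  · have := dist_lt_of_triple_balls (W.adj_parent v hv).2
    linarith

/-- Radii of a vertex and its parent are comparable: `97 r(parent v) ≤ 103 r(v)`. [folklore] -/
theorem infDist_parent_le {v : W.S} (hv : v ≠ W.root) :
    97 * infDist (W.parent v : ℂ) Ωᶜ ≤ 103 * infDist (v : ℂ) Ωᶜ :=
  infDist_le_of_triple_balls (W.adj_parent v hv).2

/-- Radii of a vertex and its parent are comparable: `97 r(v) ≤ 103 r(parent v)`. [folklore] -/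
theorem infDist_le_parent {v : W.S} (hv : v ≠ W.root) :
    97 * infDist (v : ℂ) Ωᶜ ≤ 103 * infDist (W.parent v : ℂ) Ωᶜ :=
  infDist_le_of_triple_balls (by rw [inter_comm]; exact (W.adj_parent v hv).2)

/-- The quarter discs of the Whitney family are pairwise disjoint (radius written as
`dist(·, Ωᶜ)/400`). [folklore] -/
theorem pairwiseDisjoint : W.S.PairwiseDisjoint fun x => ball x (infDist x Ωᶜ / 400) := by
  have := W.isWhitney.disjoint
  simpa only [div_div, show (100 : ℝ) * 4 = 400 by norm_num] using this

/-- **`Σ_v (q v + 1)² r(v)² < ∞` on the Whitney tree of a Hölder domain** (hypothesis (2) of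
Jones–Smirnov's Thm. 2 with `n = 2`; from `summable_sq_mul_sq_of_qhbc`). [cite: JonesSmirnov2000, Thm. 2 (2) and Cor. 4 (pp. 267–268)] -/
theorem summable_sq (φ : ConformalEquiv (ball (0 : ℂ) 1) Ω) {C α : ℝ≥0} (hα : 0 < α)
    (hH : HolderOnWith C α φ (ball (0 : ℂ) 1)) :
    Summable fun v : W.S => ((W.q v : ℝ) + 1) ^ 2 * (infDist (v : ℂ) Ωᶜ / 100) ^ 2 := by
  obtain ⟨A, B, hA, hAB⟩ := W.qhbc
  exact summable_sq_mul_sq_of_qhbc φ hα hH W.isWhitney.subset W.pairwiseDisjoint hA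
    fun x hx => hAB ⟨x, hx⟩

/-- **The tail majorant `τ`** on the Whitney tree of a Hölder domain (`exists_tailSup`, Jones–
Smirnov's Thm. 2): `τ ≥ r ≥ 0`, the radii along every ray from `x k` on sum to `≤ τ (x k)`, and
`Σ_v τ(v)² < ∞`. [cite: JonesSmirnov2000, §3 proof of Thm. 2 (pp. 274–275)] -/
theorem exists_tau (φ : ConformalEquiv (ball (0 : ℂ) 1) Ω) {C α : ℝ≥0} (hα : 0 < α)
    (hH : HolderOnWith C α φ (ball (0 : ℂ) 1)) :
    ∃ τ : W.S → ℝ, (∀ v, 0 ≤ τ v) ∧ (∀ v : W.S, infDist (v : ℂ) Ωᶜ / 100 ≤ τ v) ∧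
      (∀ x : ℕ → W.S, (∀ n, W.parent (x (n + 1)) = x n) → (∀ n, x (n + 1) ≠ W.root) →
        ∀ k, ∑' n, infDist (x (k + n) : ℂ) Ωᶜ / 100 ≤ τ (x k)) ∧
      Summable fun v => τ v ^ 2 := by
  obtain ⟨τ, h0, h1, h2, h3, -⟩ := exists_tailSup (V := W.S) (root := W.root) (parent := W.parent)
    (q := fun v : W.S => W.q v) (rad := fun v : W.S => infDist (v : ℂ) Ωᶜ / 100) W.q_parent
    (fun _ => rad_nonneg _) (W.summable_sq φ hα hH) W.finite_children
  exact ⟨τ, h0, h1, h2, h3⟩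

/-- The radii along a ray of the Whitney tree of a Hölder domain are summable. [folklore] -/
theorem summable_ray (φ : ConformalEquiv (ball (0 : ℂ) 1) Ω) {C α : ℝ≥0} (hα : 0 < α)
    (hH : HolderOnWith C α φ (ball (0 : ℂ) 1)) {x : ℕ → W.S}
    (hx : ∀ n, W.parent (x (n + 1)) = x n) (hx0 : ∀ n, x (n + 1) ≠ W.root) (k : ℕ) :
    Summable fun n => infDist (x (k + n) : ℂ) Ωᶜ / 100 :=
  summable_rad_ray (rad := fun v : W.S => infDist (v : ℂ) Ωᶜ / 100) (q := fun v : W.S => W.q v)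
    W.q_parent hx hx0 (fun _ => rad_nonneg _) (W.summable_sq φ hα hH) k

/-- **Rays land, with the tail estimate** `dist(x_k, a) ≤ 6 Σ_{n ≥ 0} r(x_{k+n})` for a ray
`x` of the Whitney tree converging to `a` (each step has length `≤ 3 (r + r')`). [cite: JonesSmirnov2000, §3 proof of Thm. 2 (p. 274)] -/
theorem dist_ray_le (φ : ConformalEquiv (ball (0 : ℂ) 1) Ω) {C α : ℝ≥0} (hα : 0 < α)
    (hH : HolderOnWith C α φ (ball (0 : ℂ) 1)) {x : ℕ → W.S}
    (hx : ∀ n, W.parent (x (n + 1)) = x n) (hx0 : ∀ n, x (n + 1) ≠ W.root) {a : ℂ}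
    (ha : Tendsto (fun n => (x n : ℂ)) atTop (𝓝 a)) (k : ℕ) :
    dist (x k : ℂ) a ≤ 6 * ∑' n, infDist (x (k + n) : ℂ) Ωᶜ / 100 := by
  have hs := W.summable_ray φ hα hH hx hx0
  set d : ℕ → ℝ := fun n =>
    3 * (infDist (x (n + 1) : ℂ) Ωᶜ / 100 + infDist (x n : ℂ) Ωᶜ / 100) with hd
  have hdsum : Summable d := by
    refine Summable.mul_left 3 (Summable.add ?_ ?_)
    · simpa [add_comm] using hs 1
    · simpa using hs 0
  have hstep : ∀ n, dist (x n : ℂ) (x (n + 1) : ℂ) ≤ d n := fun n =>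
    dist_pos_ray_succ_le (pos := fun v : W.S => (v : ℂ))
      (rad := fun v : W.S => infDist (v : ℂ) Ωᶜ / 100) (κ := 3) W.dist_parent_le hx n
  have h := dist_le_tsum_of_dist_le_of_tendsto d hstep hdsum ha k
  have e1 : ∑' m, d (k + m) = 3 * ((∑' m, infDist (x (k + 1 + m) : ℂ) Ωᶜ / 100) +
      ∑' m, infDist (x (k + m) : ℂ) Ωᶜ / 100) := by
    rw [← (hs (k + 1)).tsum_add (hs k), ← tsum_mul_left]
    refine tsum_congr fun m => ?_
    simp only [hd]
    rw [show k + m + 1 = k + 1 + m by ring]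
  have e2 : ∑' m, infDist (x (k + 1 + m) : ℂ) Ωᶜ / 100 ≤ ∑' m, infDist (x (k + m) : ℂ) Ωᶜ / 100 := by
    rw [(hs k).tsum_eq_zero_add]
    have : ∑' m, infDist (x (k + 1 + m) : ℂ) Ωᶜ / 100 = ∑' m, infDist (x (k + (m + 1)) : ℂ) Ωᶜ / 100 :=
      tsum_congr fun m => by rw [show k + 1 + m = k + (m + 1) by ring]
    rw [this]
    linarith [(infDist_nonneg (x := (x (k + 0) : ℂ)) (s := Ωᶜ))]
  calc dist (x k : ℂ) a ≤ ∑' m, d (k + m) := h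
    _ ≤ 3 * ((∑' m, infDist (x (k + m) : ℂ) Ωᶜ / 100) + ∑' m, infDist (x (k + m) : ℂ) Ωᶜ / 100) := by
        rw [e1]; gcongr
    _ = 6 * ∑' n, infDist (x (k + n) : ℂ) Ωᶜ / 100 := by ring

/-- **Every boundary point is a landing point** (Jones–Smirnov 2000, p. 274: "any point
`x ∈ ∂Ω` is a landing point of at least one curve", by König's lemma): for `z ∈ ∂Ω` there is a
ray of the Whitney tree from the root converging to `z` (the Whitney discs containing interior
points `ω_k → z` have centres accumulating exactly at `z`; `exists_ray_tendsto`). [cite: JonesSmirnov2000, §3 proof of Thm. 2 (p. 274)] -/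
theorem exists_ray_tendsto_of_mem_frontier (φ : ConformalEquiv (ball (0 : ℂ) 1) Ω) {C α : ℝ≥0}
    (hα : 0 < α) (hH : HolderOnWith C α φ (ball (0 : ℂ) 1)) {z : ℂ} (hz : z ∈ frontier Ω) :
    ∃ x : ℕ → W.S, x 0 = W.root ∧ (∀ n, W.parent (x (n + 1)) = x n) ∧
      (∀ n, x (n + 1) ≠ W.root) ∧ Tendsto (fun n => (x n : ℂ)) atTop (𝓝 z) := by
  classical
  have hΩo := isOpen_of_conformalEquiv_ball φ
  have hzΩ : z ∉ Ω := fun h => by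
    have : z ∈ Ω ∩ frontier Ω := ⟨h, hz⟩
    rw [hΩo.inter_frontier_eq] at this
    exact this
  obtain ⟨ω, hωΩ, hωz⟩ := mem_closure_iff_seq_limit.1 (frontier_subset_closure hz)
  have hcen : ∀ k, ∃ v : W.S, ω k ∈ ball (v : ℂ) (infDist (v : ℂ) Ωᶜ / 100) := fun k => by
    obtain ⟨x, hx, hkx⟩ := mem_iUnion₂.1 (W.isWhitney.cover (hωΩ k))
    exact ⟨⟨x, hx⟩, hkx⟩
  choose v hv using hcen
  have hdist : ∀ k, dist (v k : ℂ) z ≤ 2 * dist (ω k) z := by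
    intro k
    have h1 := hv k
    rw [mem_ball] at h1
    have h2 : infDist (v k : ℂ) Ωᶜ ≤ dist (v k : ℂ) z := infDist_le_dist_of_mem hzΩ
    have h3 := dist_triangle (v k : ℂ) (ω k) z
    rw [dist_comm (v k : ℂ) (ω k)] at h3
    linarith [dist_nonneg (x := (v k : ℂ)) (y := z)]
  have hvz : Tendsto (fun k => (v k : ℂ)) atTop (𝓝 z) := by
    rw [tendsto_iff_dist_tendsto_zero]
    have h0 : Tendsto (fun k => 2 * dist (ω k) z) atTop (𝓝 0) := by
      simpa using (tendsto_iff_dist_tendsto_zero.1 hωz).const_mul 2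
    exact squeeze_zero (fun k => dist_nonneg) hdist h0
  have hvz' := tendsto_iff_dist_tendsto_zero.1 hvz
  have hpos : ∀ t : W.S, 0 < dist (t : ℂ) z := fun t =>
    dist_pos.2 fun h => hzΩ (h ▸ W.isWhitney.subset t.2)
  set T : Set W.S := Set.range v with hT
  have hTinf : T.Infinite := by
    intro hfin
    have hne : (hfin.toFinset.image fun t : W.S => dist (t : ℂ) z).Nonempty :=
      (hfin.toFinset_nonempty.2 ⟨v 0, 0, rfl⟩).image _
    set m := (hfin.toFinset.image fun t : W.S => dist (t : ℂ) z).min' hne with hm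
    have hm0 : 0 < m := by
      obtain ⟨t, -, hteq⟩ := Finset.mem_image.1 ((hfin.toFinset.image fun t : W.S =>
        dist (t : ℂ) z).min'_mem hne)
      rw [hm, ← hteq]
      exact hpos t
    have hmin : ∀ k, m ≤ dist (v k : ℂ) z := fun k =>
      Finset.min'_le _ _ (Finset.mem_image.2 ⟨v k, hfin.mem_toFinset.2 ⟨k, rfl⟩, rfl⟩)
    obtain ⟨k, hk⟩ := ((tendsto_order.1 hvz').2 m hm0).exists
    exact absurd (hmin k) (not_le.2 hk)
  have hzT : ∀ ε > 0, {t ∈ T | ε ≤ dist (t : ℂ) z}.Finite := by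
    intro ε hε
    obtain ⟨N, hN⟩ := eventually_atTop.1 ((tendsto_order.1 hvz').2 ε hε)
    refine ((Set.finite_lt_nat N).image v).subset ?_
    rintro t ⟨⟨k, rfl⟩, hk⟩
    refine ⟨k, ?_, rfl⟩
    by_contra hkN
    exact absurd hk (not_le.2 (hN k (not_lt.1 hkN)))
  exact exists_ray_tendsto (V := W.S) (root := W.root) (parent := W.parent)
    (q := fun v : W.S => W.q v) (rad := fun v : W.S => infDist (v : ℂ) Ωᶜ / 100)
    (pos := fun v : W.S => (v : ℂ)) (κ := 3) W.q_parent W.dist_parent_le (by norm_num)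
    (fun _ => rad_nonneg _) (W.summable_sq φ hα hH) W.finite_children hTinf
    (fun t _ => W.reach t) hzT

/-- **Only finitely many Whitney discs are large**: in a bounded domain, for `δ₀ > 0` the
vertices with `r(v) ≥ δ₀` form a finite set (their disjoint quarter discs, of radius `≥ δ₀/4`,
lie in a fixed disc). [folklore] -/
theorem finite_setOf_le (hbd : Bornology.IsBounded Ω) {δ₀ : ℝ} (hδ : 0 < δ₀) :
    {v : W.S | δ₀ ≤ infDist (v : ℂ) Ωᶜ / 100}.Finite := by
  classical
  obtain ⟨R, hR⟩ := hbd.subset_closedBall (0 : ℂ)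
  set R' : ℝ := max R 0 with hR'
  have hR'0 : 0 ≤ R' := le_max_right _ _
  have hΩR : Ω ⊆ closedBall (0 : ℂ) R' := hR.trans (closedBall_subset_closedBall (le_max_left _ _))
  have hp : ((R' + 1 : ℝ) : ℂ) ∈ Ωᶜ := fun h => by
    have := mem_closedBall.1 (hΩR h)
    rw [dist_zero_right, Complex.norm_real, Real.norm_eq_abs, abs_of_nonneg (by positivity)] at this
    linarith
  have hd : ∀ z ∈ Ω, infDist z Ωᶜ ≤ 2 * R' + 1 := fun z hz => by
    have h1 : dist z 0 ≤ R' := mem_closedBall.1 (hΩR hz)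
    calc infDist z Ωᶜ ≤ dist z ((R' + 1 : ℝ) : ℂ) := infDist_le_dist_of_mem hp
      _ ≤ dist z 0 + dist (0 : ℂ) ((R' + 1 : ℝ) : ℂ) := dist_triangle _ _ _
      _ = dist z 0 + (R' + 1) := by
          congr 1
          rw [dist_comm (0 : ℂ), dist_zero_right, Complex.norm_real, Real.norm_eq_abs,
            abs_of_nonneg (by positivity)]
      _ ≤ 2 * R' + 1 := by linarith
  by_contra hinf
  set N : ℕ := ⌊16 * (3 * R' + 2) ^ 2 / δ₀ ^ 2⌋₊ + 1 with hN
  obtain ⟨F, hFsub, hFcard⟩ := (Set.not_finite.1 hinf).exists_subset_card_eq N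
  have hF : ∀ x ∈ F.image (fun v : W.S => (v : ℂ)), x ∈ W.S ∧ δ₀ ≤ infDist x Ωᶜ / 100 := by
    intro x hx
    obtain ⟨v, hv, rfl⟩ := Finset.mem_image.1 hx
    exact ⟨v.2, hFsub (Finset.mem_coe.2 hv)⟩
  have key := card_mul_le_of_disjoint_balls (F := F.image fun v : W.S => (v : ℂ))
    (ρ := fun x => infDist x Ωᶜ / 400) (ρ₀ := δ₀ / 4) (V := Real.pi * (3 * R' + 2) ^ 2)
    (T := ball 0 (3 * R' + 2)) (by positivity) (by positivity)
    (fun x hx => by have := (hF x hx).2; change δ₀ / 4 ≤ infDist x Ωᶜ / 400; linarith)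
    (W.pairwiseDisjoint.subset fun x hx => (hF x (Finset.mem_coe.1 hx)).1) (fun x hx => ?_)
    (Dyadic.volume_ball_le 0 (by positivity))
  · rw [Finset.card_image_of_injective _ Subtype.val_injective, hFcard] at key
    have h1 : (N : ℝ) * δ₀ ^ 2 ≤ 16 * (3 * R' + 2) ^ 2 := by
      have := key
      nlinarith [Real.pi_pos, hδ]
    have h2 : (16 * (3 * R' + 2) ^ 2 / δ₀ ^ 2 : ℝ) < N := by
      simp only [hN]
      push_cast
      exact Nat.lt_floor_add_one _
    rw [div_lt_iff₀ (by positivity)] at h2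
    linarith
  · intro y hy
    have h1 := hd x (W.isWhitney.subset (hF x hx).1)
    have h2 : dist x 0 ≤ R' := mem_closedBall.1 (hΩR (W.isWhitney.subset (hF x hx).1))
    rw [mem_ball] at hy ⊢
    calc dist y 0 ≤ dist y x + dist x 0 := dist_triangle _ _ _
      _ < 3 * R' + 2 := by linarith [infDist_nonneg (x := x) (s := Ωᶜ)]

end WhitneyTree

end Literature.Probability.RandomPlanarGeometry
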